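import Literature.NumberTheory.LFunctions.WeilTwoPrimeCellsT80
import Literature.NumberTheory.LFunctions.WeilTwoPrimeCertificate
import HarnessLib

/-!
# Splitting the moment check of a two-prime certificate over the cell chunks of `[0, 80]`

Topic: `Literature/NumberTheory/LFunctions`. One entry `checkNuAt q` of the moment check of a `WeilCert23`
(`WeilTwoPrimeCertificate.lean`) re-derives `ν_q = a₀^q · 2 · cellsMomentQ₂₃ wL cells q` over all cells; for the
248 cells of `weilTwoPrimeCellsT80` and `q` up to `≈ 300` this is `≈ 70 s` of kernel time, above one declaration's
budget. `cellsMomentQ₂₃` is additive over list concatenation (`cellsMomentQ₂₃_append`), and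
`weilTwoPrimeCellsT80 = C0 ++ C1 ++ C2` by definition, so the cell sum splits into four kernel facts
(`C0`, `C1.take 53`, `C1.drop 53`, `C2`) with materialized partial values, and **`WeilCert23.checkNuAt_of_partsT80`**
recovers `checkNuAt q` for any certificate whose cells are `weilTwoPrimeCellsT80` and whose level is
`weilTwoPrimeCellsT80Level`, from the four facts and an inequality between literals. Pure bookkeeping; proved.
-/

namespace Literature.NumberTheory.LFunctions

/-- `cellsMomentQ₂₃` is additive over concatenation. [folklore] -/
theorem cellsMomentQ₂₃_append (wL : ℚ) (A B : List TPDCell) (q : ℕ) :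
    cellsMomentQ₂₃ wL (A ++ B) q = cellsMomentQ₂₃ wL A q + cellsMomentQ₂₃ wL B q := by
  induction A with
  | nil => simp [cellsMomentQ₂₃]
  | cons c cs ih => simp only [List.cons_append, cellsMomentQ₂₃, ih, add_assoc]

/-- The cell sum on `[0, 80]` split over the four kernel-sized chunks. [folklore] -/
theorem cellsMomentQ₂₃_T80_split (wL : ℚ) (q : ℕ) :
    cellsMomentQ₂₃ wL weilTwoPrimeCellsT80 q =
      cellsMomentQ₂₃ wL weilTwoPrimeCellsT80C0 q + cellsMomentQ₂₃ wL (weilTwoPrimeCellsT80C1.take 53) q +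
        cellsMomentQ₂₃ wL (weilTwoPrimeCellsT80C1.drop 53) q + cellsMomentQ₂₃ wL weilTwoPrimeCellsT80C2 q := by
  unfold weilTwoPrimeCellsT80
  rw [cellsMomentQ₂₃_append, cellsMomentQ₂₃_append, ← List.take_append_drop 53 weilTwoPrimeCellsT80C1,
    cellsMomentQ₂₃_append, List.take_append_drop]
  ring

/-- **One entry of the moment check from the four partial sums.** For a certificate `c` with the cells and the
level of the chain on `[0, 80]`: if the four chunk sums have the values `v₀, v₁, v₂, v₃` and the claimed entry
passes `|ν̃_q − nuScale · a₀^q · 2 (v₀+v₁+v₂+v₃)| ≤ 2^{-pnu}`, then `c.checkNuAt q`. [folklore] -/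
theorem WeilCert23.checkNuAt_of_partsT80 (c : WeilCert23) (hcells : c.cells = weilTwoPrimeCellsT80)
    (hwL : c.base.wL = weilTwoPrimeCellsT80Level) (q : ℕ) {v₀ v₁ v₂ v₃ : ℚ}
    (h₀ : cellsMomentQ₂₃ weilTwoPrimeCellsT80Level weilTwoPrimeCellsT80C0 q = v₀)
    (h₁ : cellsMomentQ₂₃ weilTwoPrimeCellsT80Level (weilTwoPrimeCellsT80C1.take 53) q = v₁)
    (h₂ : cellsMomentQ₂₃ weilTwoPrimeCellsT80Level (weilTwoPrimeCellsT80C1.drop 53) q = v₂)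
    (h₃ : cellsMomentQ₂₃ weilTwoPrimeCellsT80Level weilTwoPrimeCellsT80C2 q = v₃)
    (hlit : |getV c.nuData q - nuScale * (c.base.a0 ^ q * (2 * (v₀ + v₁ + v₂ + v₃)))| ≤ 1 / 2 ^ c.pnu) :
    c.checkNuAt q = true := by
  unfold WeilCert23.checkNuAt WeilCert23.nuQ
  rw [decide_eq_true_eq, hcells, hwL, cellsMomentQ₂₃_T80_split, h₀, h₁, h₂, h₃]
  exact hlit

end Literature.NumberTheory.LFunctions
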